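import Summits.QuantumFields.YangMills.Theorems.BalabanLadderIRTwistedSlabLogChart
import Summits.QuantumFields.YangMills.Theorems.BalabanLadderIRTwistedSlabRealHodge
import HarnessLib

/-!
# The slice chart on `𝔰𝔲` data: `Ψ̂ : suFields × realCoulombSlice L → (Fin 4 → suFields)` is strictly differentiable at `0` with an
# INVERTIBLE differential at the twist-eating ladder, hence a local homeomorphism (inverse function theorem) — tubular coordinates of M1b

HELPER toward stub **T1** `TwistedSlabAnchor` (LINE `twisted-slab-continuity`, crux `IRcof` stmt-QuantumFields-26930, census row 43;
LEAD prover ym-ir-line-tsc-p1 g3; `--supports` the crux, `--as helper`).  Sequel of K15a (`…LogChart`: `slicePsi`, `hasStrictFDerivAt_slicePsi_zero`,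
`eventually_slicePsi_skew_traceless`) and K14 (`…RealHodge`: `realGaugeSliceEquiv` over `ℝ`).
* §1 `suDataIncl L` (the inclusion `suFields × realCoulombSlice L ↪ ambient` as a continuous linear map), `suPiIncl` (the inclusion
  `(Fin 4 → suFields) ↪ ambient`, norm-preserving: `norm_suPiIncl`), ★ `slicePsiSu L` (the chart read on `𝔰𝔲` data with `𝔰𝔲` values; the
  ambient chart agrees with it near `0`: `eventually_coe_slicePsiSu`), `slicePsiSu_zero`.
* §2 (twist-eating ladder `L = ladderField ![A, B, Γ₂, Γ₃]` in `SU(N)`, `A, B` a unitary Weyl pair, `ω` primitive, `N(m+1) ≥ 2`):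
  `slicePsiSuDeriv` — the differential `(φ, y) ↦ y − ∇⁺φ` as a continuous linear EQUIVALENCE `suFields × realCoulombSlice L ≃L (Fin 4 → suFields)`
  (K14 composed with `φ ↦ −φ`), `coe_slicePsiSuDeriv_apply`; ★★★ `hasStrictFDerivAt_slicePsiSu_zero` :
  `HasStrictFDerivAt (slicePsiSu L) (slicePsiSuDeriv … : _ →L[ℝ] _) 0`; ★★ `sliceChart` := Mathlib's `HasStrictFDerivAt.toOpenPartialHomeomorph` —
  the TUBULAR COORDINATES `(φ, y) ↦ log-coordinates of e^{φ} • (e^{y}·L)` as an open partial homeomorphism between spaces of equal (finite)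
  dimension, with `sliceChart_coe`, `zero_mem_sliceChart_source`, `map_nhds_slicePsiSu_zero` (`Ψ̂` maps neighbourhoods of `0` onto neighbourhoods
  of `0`: every small `𝔰𝔲`-fluctuation of `L` is a small gauge transform of a small Coulomb-slice fluctuation), and `eventually_exp_slicePsiSu_mul`
  (`exp(Ψ̂(q)_μ(x)) · L(x,μ) = orbitFluct L q (μ, x)` near `0`).
NOT here (honest scope): the Haar∕Lebesgue densities and the `hchart` identity of lit-4's `tendsto_laplaceMethod_fibred_chart` (L10∕L16 supply the
group side; the Jacobian continuity of `Ψ̂` near `0` is routine from `contDiffAt_slicePsi` but not packaged here), the Faddeev–Popov localisation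
(L15), anything uniform in `β` (M3), the cluster expansion (M4); T1-box 0∕1, T1 proper 0∕1.

HONEST FRAMING: finite-dimensional calculus on one box; nothing here bears on `IRcof`, `IR`, or the Yang–Mills mass gap (Clay: NOT proved); R4 =
`BalabanLadder.UV` only.  References: M. García Pérez, A. González-Arroyo, M. Okawa, JHEP 10 (2017) 150 §2.3, §2.5; I. Montvay, G. Münster, *Quantum
Fields on a Lattice* §3.2.5 (gauge fixing, Faddeev–Popov); S. Helgason, *Groups and Geometric Analysis* Ch. I §1 Thm 1.14.
-/

set_option autoImplicit false

noncomputable section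

open scoped Matrix Matrix.Norms.Frobenius Topology
open Finset NormedSpace Filter Asymptotics
open Literature.MathematicalPhysics.QuantumFieldTheory Literature.MathematicalPhysics.QuantumLattice
open Literature.Analysis.OperatorTheory

namespace Summit.QuantumFields.YangMills.Cruxes.IRcof.TwistedSlab

variable {N : ℕ} {n₀ n₁ n₂ n₃ : ℕ}

/-! ## §1 The chart on `𝔰𝔲` data -/

section SuData

variable (L : FinTorusSite n₀ n₁ n₂ n₃ × Fin 4 → Matrix (Fin N) (Fin N) ℂ)

/-- The inclusion of `𝔰𝔲` data `(φ, y) ∈ suFields × realCoulombSlice L` into the ambient pair of field spaces, as a continuous linear map. [folklore] -/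
def suDataIncl : (suFields N n₀ n₁ n₂ n₃ × realCoulombSlice L) →L[ℝ]
    ((FinTorusSite n₀ n₁ n₂ n₃ → Matrix (Fin N) (Fin N) ℂ) × (Fin 4 → FinTorusSite n₀ n₁ n₂ n₃ → Matrix (Fin N) (Fin N) ℂ)) :=
  ((suFields N n₀ n₁ n₂ n₃).subtypeL).prodMap ((realCoulombSlice L).subtypeL)

/-- Components of the inclusion. [folklore] -/
@[simp] theorem suDataIncl_apply (q : suFields N n₀ n₁ n₂ n₃ × realCoulombSlice L) :
    suDataIncl L q = ((q.1 : FinTorusSite n₀ n₁ n₂ n₃ → Matrix (Fin N) (Fin N) ℂ),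
      (q.2 : Fin 4 → FinTorusSite n₀ n₁ n₂ n₃ → Matrix (Fin N) (Fin N) ℂ)) := rfl

variable (N n₀ n₁ n₂ n₃) in
/-- The inclusion `(Fin 4 → suFields) ↪ (Fin 4 → ambient fields)` as a continuous linear map. [folklore] -/
def suPiIncl : (Fin 4 → suFields N n₀ n₁ n₂ n₃) →L[ℝ] (Fin 4 → FinTorusSite n₀ n₁ n₂ n₃ → Matrix (Fin N) (Fin N) ℂ) :=
  ContinuousLinearMap.pi fun μ => ((suFields N n₀ n₁ n₂ n₃).subtypeL).comp (ContinuousLinearMap.proj μ)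

/-- Components of `suPiIncl`. [folklore] -/
@[simp] theorem suPiIncl_apply (v : Fin 4 → suFields N n₀ n₁ n₂ n₃) (μ : Fin 4) :
    suPiIncl N n₀ n₁ n₂ n₃ v μ = ((v μ : suFields N n₀ n₁ n₂ n₃) : FinTorusSite n₀ n₁ n₂ n₃ → Matrix (Fin N) (Fin N) ℂ) := rfl

/-- `suPiIncl` preserves the (sup-Frobenius) norm. [folklore] -/
theorem norm_suPiIncl (v : Fin 4 → suFields N n₀ n₁ n₂ n₃) : ‖suPiIncl N n₀ n₁ n₂ n₃ v‖ = ‖v‖ := by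
  apply le_antisymm
  · refine (pi_norm_le_iff_of_nonneg (norm_nonneg v)).2 fun μ => ?_
    exact (norm_le_pi_norm v μ : ‖v μ‖ ≤ ‖v‖)
  · refine (pi_norm_le_iff_of_nonneg (norm_nonneg _)).2 fun μ => ?_
    exact (norm_le_pi_norm (suPiIncl N n₀ n₁ n₂ n₃ v) μ :
      ‖((v μ : suFields N n₀ n₁ n₂ n₃) : FinTorusSite n₀ n₁ n₂ n₃ → Matrix (Fin N) (Fin N) ℂ)‖ ≤ ‖suPiIncl N n₀ n₁ n₂ n₃ v‖)

/-- `suPiIncl` is injective. [folklore] -/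
theorem suPiIncl_injective : Function.Injective (suPiIncl N n₀ n₁ n₂ n₃) := by
  intro v w h
  funext μ
  apply Subtype.ext
  exact congrFun h μ

open Classical in
/-- ★ **The slice chart on `𝔰𝔲` data with `𝔰𝔲` values**: `slicePsiSu L (φ, y) μ = Ψ(φ, y)_μ ∈ suFields` whenever it is `𝔰𝔲`-valued (which is the
case near `0`, K15a), and `0` otherwise (unused branch). [cite: GarciaperezGonzalezarroyoOkawa2017, §2.3, §2.5] -/
def slicePsiSu (q : suFields N n₀ n₁ n₂ n₃ × realCoulombSlice L) : Fin 4 → suFields N n₀ n₁ n₂ n₃ :=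
  fun μ => if h : slicePsi L (suDataIncl L q) μ ∈ suFields N n₀ n₁ n₂ n₃ then ⟨slicePsi L (suDataIncl L q) μ, h⟩ else 0

variable {L}

/-- Near `0` the ambient chart of `𝔰𝔲` data is `𝔰𝔲`-valued (`L ∈ SU(N)^E`). [cite: MontvayMunster1994, §3.2.5 p. 122] -/
theorem eventually_slicePsi_suDataIncl_mem (hL : ∀ e, L e ∈ Matrix.specialUnitaryGroup (Fin N) ℂ) :
    ∀ᶠ q in 𝓝 (0 : suFields N n₀ n₁ n₂ n₃ × realCoulombSlice L), ∀ μ, slicePsi L (suDataIncl L q) μ ∈ suFields N n₀ n₁ n₂ n₃ := by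
  have ht : Tendsto (suDataIncl L) (𝓝 0) (𝓝 0) := by
    have h := (suDataIncl L).continuous.tendsto 0
    rwa [map_zero] at h
  refine (ht.eventually (eventually_slicePsi_skew_traceless hL)).mono fun q hq μ => ?_
  rw [mem_suFields]
  intro x
  exact hq (fun x => q.1.2 x) (fun μ x => (q.2.2).1 μ x) μ x

/-- ★ Near `0`, `slicePsiSu` IS the ambient chart: `↑(Ψ̂(q) μ) = Ψ(q)_μ`. [folklore] -/
theorem eventually_coe_slicePsiSu (hL : ∀ e, L e ∈ Matrix.specialUnitaryGroup (Fin N) ℂ) :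
    ∀ᶠ q in 𝓝 (0 : suFields N n₀ n₁ n₂ n₃ × realCoulombSlice L),
      suPiIncl N n₀ n₁ n₂ n₃ (slicePsiSu L q) = slicePsi L (suDataIncl L q) := by
  refine (eventually_slicePsi_suDataIncl_mem hL).mono fun q hq => ?_
  funext μ
  rw [suPiIncl_apply, slicePsiSu, dif_pos (hq μ)]

/-- `Ψ̂(0) = 0`. [folklore] -/
theorem slicePsiSu_zero (hL : ∀ e, L e ∈ Matrix.unitaryGroup (Fin N) ℂ) : slicePsiSu L 0 = 0 := by
  funext μ
  have h0 : slicePsi L (suDataIncl L 0) μ = 0 := by rw [map_zero, slicePsi_zero hL]; rfl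
  have hmem : slicePsi L (suDataIncl L 0) μ ∈ suFields N n₀ n₁ n₂ n₃ := by rw [h0]; exact (suFields N n₀ n₁ n₂ n₃).zero_mem
  rw [slicePsiSu, dif_pos hmem]
  apply Subtype.ext
  show slicePsi L (suDataIncl L 0) μ = _
  rw [h0]
  rfl

/-- ★ Near `0`: `exp(Ψ̂(q)_μ(x)) · L(x,μ) = orbitFluct L q (μ, x)` — the chart inverts the exponential tubular coordinates. [cite: Helgason2000, Ch. I §1 Thm 1.14 p. 96] -/
theorem eventually_exp_slicePsiSu_mul (hL : ∀ e, L e ∈ Matrix.specialUnitaryGroup (Fin N) ℂ) :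
    ∀ᶠ q in 𝓝 (0 : suFields N n₀ n₁ n₂ n₃ × realCoulombSlice L), ∀ μ x,
      exp (((slicePsiSu L q μ : suFields N n₀ n₁ n₂ n₃) : FinTorusSite n₀ n₁ n₂ n₃ → Matrix (Fin N) (Fin N) ℂ) x) * L (x, μ) =
        orbitFluct L (suDataIncl L q) μ x := by
  have hLu : ∀ e, L e ∈ Matrix.unitaryGroup (Fin N) ℂ := fun e => (Matrix.mem_specialUnitaryGroup_iff.1 (hL e)).1
  have ht : Tendsto (suDataIncl L) (𝓝 0) (𝓝 0) := by
    have h := (suDataIncl L).continuous.tendsto 0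
    rwa [map_zero] at h
  filter_upwards [eventually_coe_slicePsiSu hL, ht.eventually (eventually_norm_orbitFluct_mul_conjTranspose_sub_one_lt hLu one_pos)]
    with q hq hwin μ x
  have h := congrFun (congrFun hq μ) x
  rw [suPiIncl_apply] at h
  rw [h]
  exact exp_slicePsi_mul hLu (hwin μ x)

/-- **Transfer of strict differentiability to the `𝔰𝔲`-valued chart**: if a continuous linear `D` intertwines the inclusions with the ambient
differential (`suPiIncl ∘ D = slicePsiDeriv L ∘ suDataIncl L`), then `Ψ̂` has strict differential `D` at `0` (`L ∈ SU(N)^E`): near `0` the `𝔰𝔲`-valued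
chart is the ambient chart read through the norm-preserving inclusion. [cite: MontvayMunster1994, §3.2.5 p. 122] -/
theorem hasStrictFDerivAt_slicePsiSu_of_intertwines (hL : ∀ e, L e ∈ Matrix.specialUnitaryGroup (Fin N) ℂ)
    (D : (suFields N n₀ n₁ n₂ n₃ × realCoulombSlice L) →L[ℝ] (Fin 4 → suFields N n₀ n₁ n₂ n₃))
    (hD : (suPiIncl N n₀ n₁ n₂ n₃).comp D = (slicePsiDeriv L).comp (suDataIncl L)) :
    HasStrictFDerivAt (slicePsiSu L) D 0 := by
  have hLu : ∀ e, L e ∈ Matrix.unitaryGroup (Fin N) ℂ := fun e => (Matrix.mem_specialUnitaryGroup_iff.1 (hL e)).1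
  have hι : HasStrictFDerivAt (suDataIncl L) (suDataIncl L) 0 := (suDataIncl L).hasStrictFDerivAt
  have hΨ : HasStrictFDerivAt (slicePsi L) (slicePsiDeriv L) (suDataIncl L 0) := by
    rw [map_zero]; exact hasStrictFDerivAt_slicePsi_zero hLu
  have hcomp := hΨ.comp 0 hι
  have hJ : HasStrictFDerivAt (fun q => suPiIncl N n₀ n₁ n₂ n₃ (slicePsiSu L q)) ((suPiIncl N n₀ n₁ n₂ n₃).comp D) 0 := by
    rw [hD]
    exact hcomp.congr_of_eventuallyEq ((eventually_coe_slicePsiSu hL).mono fun q hq => hq.symm)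
  have hJ' := (hasStrictFDerivAt_iff_isLittleO).1 hJ
  refine (hasStrictFDerivAt_iff_isLittleO).2 (IsLittleO.of_norm_left ?_)
  refine (hJ'.norm_left).congr' (Eventually.of_forall fun p => ?_) EventuallyEq.rfl
  show ‖suPiIncl N n₀ n₁ n₂ n₃ (slicePsiSu L p.1) - suPiIncl N n₀ n₁ n₂ n₃ (slicePsiSu L p.2) -
      suPiIncl N n₀ n₁ n₂ n₃ (D (p.1 - p.2))‖ = ‖slicePsiSu L p.1 - slicePsiSu L p.2 - D (p.1 - p.2)‖
  rw [← map_sub, ← map_sub, norm_suPiIncl]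

end SuData

/-! ## §2 The invertible differential at the twist-eating ladder and the inverse function theorem -/

section Ladder

variable [NeZero N] {m n₂' n₃' : ℕ} {A B : Matrix (Fin N) (Fin N) ℂ} {ω : ℂ} {Γ₂ Γ₃ : Matrix (Fin N) (Fin N) ℂ}

/-- Components of K14's `realGaugeSliceEquiv`: `(φ, y) ↦ (μ ↦ ∇⁺_μ φ + y μ)`. [cite: GarciaperezGonzalezarroyoOkawa2017, §2.5] -/
theorem coe_realGaugeSliceEquiv_apply (hAu : A ∈ Matrix.unitaryGroup (Fin N) ℂ) (hBu : B ∈ Matrix.unitaryGroup (Fin N) ℂ) (hω : IsPrimitiveRoot ω N)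
    (hAB : A * B = ω • (B * A)) (hNm : 2 ≤ N * (m + 1))
    (hU : ∀ e, ladderField (n₀ := m + 1) (n₁ := m + 1) (n₂ := n₂') (n₃ := n₃') ![A, B, Γ₂, Γ₃] e ∈ Matrix.unitaryGroup (Fin N) ℂ)
    (q : suFields N (m + 1) (m + 1) n₂' n₃' × realCoulombSlice (ladderField (n₀ := m + 1) (n₁ := m + 1) (n₂ := n₂') (n₃ := n₃') ![A, B, Γ₂, Γ₃]))
    (μ : Fin 4) :
    ((realGaugeSliceEquiv hAu hBu hω hAB hNm hU q μ : suFields N (m + 1) (m + 1) n₂' n₃') : FinTorusSite (m + 1) (m + 1) n₂' n₃' → Matrix (Fin N) (Fin N) ℂ) =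
      fun x => covDeriv (ladderField ![A, B, Γ₂, Γ₃]) μ (q.1 : FinTorusSite (m + 1) (m + 1) n₂' n₃' → Matrix (Fin N) (Fin N) ℂ) x +
        (q.2 : Fin 4 → FinTorusSite (m + 1) (m + 1) n₂' n₃' → Matrix (Fin N) (Fin N) ℂ) μ x := by
  rfl

/-- **The differential of the slice chart as a continuous linear EQUIVALENCE** `suFields × realCoulombSlice L ≃L (Fin 4 → suFields)`,
`(φ, y) ↦ y − ∇⁺φ` (K14's `realGaugeSliceEquiv` precomposed with `φ ↦ −φ`; finite dimension gives continuity), at the twist-eating ladder in `SU(N)`.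
[cite: GarciaperezGonzalezarroyoOkawa2017, §2.5] [cite: MontvayMunster1994, §3.2.5 p. 122] -/
def slicePsiSuDeriv (hAu : A ∈ Matrix.unitaryGroup (Fin N) ℂ) (hBu : B ∈ Matrix.unitaryGroup (Fin N) ℂ) (hω : IsPrimitiveRoot ω N)
    (hAB : A * B = ω • (B * A)) (hNm : 2 ≤ N * (m + 1))
    (hL : ∀ e, ladderField (n₀ := m + 1) (n₁ := m + 1) (n₂ := n₂') (n₃ := n₃') ![A, B, Γ₂, Γ₃] e ∈ Matrix.specialUnitaryGroup (Fin N) ℂ) :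
    (suFields N (m + 1) (m + 1) n₂' n₃' × realCoulombSlice (ladderField (n₀ := m + 1) (n₁ := m + 1) (n₂ := n₂') (n₃ := n₃') ![A, B, Γ₂, Γ₃])) ≃L[ℝ]
      (Fin 4 → suFields N (m + 1) (m + 1) n₂' n₃') :=
  (((LinearEquiv.neg ℝ).prodCongr (LinearEquiv.refl ℝ _)).trans
    (realGaugeSliceEquiv hAu hBu hω hAB hNm fun e => (Matrix.mem_specialUnitaryGroup_iff.1 (hL e)).1)).toContinuousLinearEquiv

/-- Components of the differential: `(slicePsiSuDeriv (φ, y) μ)(x) = y_μ(x) − ∇⁺_μ φ(x)`. [cite: GarciaperezGonzalezarroyoOkawa2017, §2.5] -/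
theorem coe_slicePsiSuDeriv_apply (hAu : A ∈ Matrix.unitaryGroup (Fin N) ℂ) (hBu : B ∈ Matrix.unitaryGroup (Fin N) ℂ) (hω : IsPrimitiveRoot ω N)
    (hAB : A * B = ω • (B * A)) (hNm : 2 ≤ N * (m + 1))
    (hL : ∀ e, ladderField (n₀ := m + 1) (n₁ := m + 1) (n₂ := n₂') (n₃ := n₃') ![A, B, Γ₂, Γ₃] e ∈ Matrix.specialUnitaryGroup (Fin N) ℂ)
    (q : suFields N (m + 1) (m + 1) n₂' n₃' × realCoulombSlice (ladderField (n₀ := m + 1) (n₁ := m + 1) (n₂ := n₂') (n₃ := n₃') ![A, B, Γ₂, Γ₃]))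
    (μ : Fin 4) :
    ((slicePsiSuDeriv hAu hBu hω hAB hNm hL q μ : suFields N (m + 1) (m + 1) n₂' n₃') : FinTorusSite (m + 1) (m + 1) n₂' n₃' → Matrix (Fin N) (Fin N) ℂ) =
      fun x => (q.2 : Fin 4 → FinTorusSite (m + 1) (m + 1) n₂' n₃' → Matrix (Fin N) (Fin N) ℂ) μ x -
        covDeriv (ladderField ![A, B, Γ₂, Γ₃]) μ (q.1 : FinTorusSite (m + 1) (m + 1) n₂' n₃' → Matrix (Fin N) (Fin N) ℂ) x := by
  have h : slicePsiSuDeriv hAu hBu hω hAB hNm hL q =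
      realGaugeSliceEquiv hAu hBu hω hAB hNm (fun e => (Matrix.mem_specialUnitaryGroup_iff.1 (hL e)).1) (-q.1, q.2) := rfl
  rw [h, coe_realGaugeSliceEquiv_apply]
  funext x
  rw [Prod.fst, Prod.snd, Submodule.coe_neg, covDeriv, covDeriv, covShift, covShift, Pi.neg_apply, Pi.neg_apply, Matrix.mul_neg, Matrix.neg_mul]
  abel

/-- The differential intertwines the inclusions: `suPiIncl ∘ slicePsiSuDeriv = slicePsiDeriv L ∘ suDataIncl`. [folklore] -/
theorem suPiIncl_comp_slicePsiSuDeriv (hAu : A ∈ Matrix.unitaryGroup (Fin N) ℂ) (hBu : B ∈ Matrix.unitaryGroup (Fin N) ℂ) (hω : IsPrimitiveRoot ω N)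
    (hAB : A * B = ω • (B * A)) (hNm : 2 ≤ N * (m + 1))
    (hL : ∀ e, ladderField (n₀ := m + 1) (n₁ := m + 1) (n₂ := n₂') (n₃ := n₃') ![A, B, Γ₂, Γ₃] e ∈ Matrix.specialUnitaryGroup (Fin N) ℂ) :
    (suPiIncl N (m + 1) (m + 1) n₂' n₃').comp (slicePsiSuDeriv hAu hBu hω hAB hNm hL : _ →L[ℝ] (Fin 4 → suFields N (m + 1) (m + 1) n₂' n₃')) =
      (slicePsiDeriv (ladderField (n₀ := m + 1) (n₁ := m + 1) (n₂ := n₂') (n₃ := n₃') ![A, B, Γ₂, Γ₃])).comp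
        (suDataIncl (ladderField (n₀ := m + 1) (n₁ := m + 1) (n₂ := n₂') (n₃ := n₃') ![A, B, Γ₂, Γ₃])) := by
  refine ContinuousLinearMap.ext fun q => ?_
  funext μ x
  rw [ContinuousLinearMap.comp_apply, ContinuousLinearMap.comp_apply, suPiIncl_apply, ContinuousLinearEquiv.coe_coe, coe_slicePsiSuDeriv_apply,
    suDataIncl_apply, slicePsiDeriv_apply]

/-- ★★★ **THE SLICE CHART IS STRICTLY DIFFERENTIABLE AT `0` WITH INVERTIBLE DIFFERENTIAL** `(φ, y) ↦ y − ∇⁺φ` (twist-eating ladder in `SU(N)`):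
near `0` the `𝔰𝔲`-valued chart is the ambient chart (K15a) read through the norm-preserving inclusions, whose strict differential is
`slicePsiDeriv ∘ suDataIncl = suPiIncl ∘ slicePsiSuDeriv`. [cite: GarciaperezGonzalezarroyoOkawa2017, §2.5] [cite: MontvayMunster1994, §3.2.5 p. 122] -/
theorem hasStrictFDerivAt_slicePsiSu_zero (hAu : A ∈ Matrix.unitaryGroup (Fin N) ℂ) (hBu : B ∈ Matrix.unitaryGroup (Fin N) ℂ) (hω : IsPrimitiveRoot ω N)
    (hAB : A * B = ω • (B * A)) (hNm : 2 ≤ N * (m + 1))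
    (hL : ∀ e, ladderField (n₀ := m + 1) (n₁ := m + 1) (n₂ := n₂') (n₃ := n₃') ![A, B, Γ₂, Γ₃] e ∈ Matrix.specialUnitaryGroup (Fin N) ℂ) :
    HasStrictFDerivAt (slicePsiSu (ladderField (n₀ := m + 1) (n₁ := m + 1) (n₂ := n₂') (n₃ := n₃') ![A, B, Γ₂, Γ₃]))
      (slicePsiSuDeriv hAu hBu hω hAB hNm hL : _ →L[ℝ] (Fin 4 → suFields N (m + 1) (m + 1) n₂' n₃')) 0 :=
  hasStrictFDerivAt_slicePsiSu_of_intertwines hL _ (suPiIncl_comp_slicePsiSuDeriv hAu hBu hω hAB hNm hL)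

/-- ★★ **THE SLICE CHART AS AN OPEN PARTIAL HOMEOMORPHISM (inverse function theorem)**: tubular coordinates `(φ, y) ↦ Ψ̂(φ, y)` around the
twist-eating ladder, between `suFields × realCoulombSlice L` and `Fin 4 → suFields` (equal finite dimension), a homeomorphism between open
neighbourhoods of `0`. [cite: GarciaperezGonzalezarroyoOkawa2017, §2.3, §2.5] [cite: MontvayMunster1994, §3.2.5 p. 122] -/
def sliceChart (hAu : A ∈ Matrix.unitaryGroup (Fin N) ℂ) (hBu : B ∈ Matrix.unitaryGroup (Fin N) ℂ) (hω : IsPrimitiveRoot ω N)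
    (hAB : A * B = ω • (B * A)) (hNm : 2 ≤ N * (m + 1))
    (hL : ∀ e, ladderField (n₀ := m + 1) (n₁ := m + 1) (n₂ := n₂') (n₃ := n₃') ![A, B, Γ₂, Γ₃] e ∈ Matrix.specialUnitaryGroup (Fin N) ℂ) :
    OpenPartialHomeomorph
      (suFields N (m + 1) (m + 1) n₂' n₃' × realCoulombSlice (ladderField (n₀ := m + 1) (n₁ := m + 1) (n₂ := n₂') (n₃ := n₃') ![A, B, Γ₂, Γ₃]))
      (Fin 4 → suFields N (m + 1) (m + 1) n₂' n₃') :=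
  haveI : IsUniformAddGroup (suFields N (m + 1) (m + 1) n₂' n₃') := (suFields N (m + 1) (m + 1) n₂' n₃').toAddSubgroup.isUniformAddGroup
  haveI : IsUniformAddGroup (realCoulombSlice (ladderField (n₀ := m + 1) (n₁ := m + 1) (n₂ := n₂') (n₃ := n₃') ![A, B, Γ₂, Γ₃])) :=
    (realCoulombSlice (ladderField (n₀ := m + 1) (n₁ := m + 1) (n₂ := n₂') (n₃ := n₃') ![A, B, Γ₂, Γ₃])).toAddSubgroup.isUniformAddGroup
  haveI : CompleteSpace (suFields N (m + 1) (m + 1) n₂' n₃') := FiniteDimensional.complete ℝ _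
  haveI : CompleteSpace (realCoulombSlice (ladderField (n₀ := m + 1) (n₁ := m + 1) (n₂ := n₂') (n₃ := n₃') ![A, B, Γ₂, Γ₃])) :=
    FiniteDimensional.complete ℝ _
  (hasStrictFDerivAt_slicePsiSu_zero hAu hBu hω hAB hNm hL).toOpenPartialHomeomorph _

/-- The slice chart is `slicePsiSu` as a function. [folklore] -/
theorem sliceChart_coe (hAu : A ∈ Matrix.unitaryGroup (Fin N) ℂ) (hBu : B ∈ Matrix.unitaryGroup (Fin N) ℂ) (hω : IsPrimitiveRoot ω N)
    (hAB : A * B = ω • (B * A)) (hNm : 2 ≤ N * (m + 1))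
    (hL : ∀ e, ladderField (n₀ := m + 1) (n₁ := m + 1) (n₂ := n₂') (n₃ := n₃') ![A, B, Γ₂, Γ₃] e ∈ Matrix.specialUnitaryGroup (Fin N) ℂ) :
    ⇑(sliceChart hAu hBu hω hAB hNm hL) = slicePsiSu (ladderField (n₀ := m + 1) (n₁ := m + 1) (n₂ := n₂') (n₃ := n₃') ![A, B, Γ₂, Γ₃]) :=
  HasStrictFDerivAt.toOpenPartialHomeomorph_coe _

/-- `0` lies in the source of the slice chart. [folklore] -/
theorem zero_mem_sliceChart_source (hAu : A ∈ Matrix.unitaryGroup (Fin N) ℂ) (hBu : B ∈ Matrix.unitaryGroup (Fin N) ℂ) (hω : IsPrimitiveRoot ω N)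
    (hAB : A * B = ω • (B * A)) (hNm : 2 ≤ N * (m + 1))
    (hL : ∀ e, ladderField (n₀ := m + 1) (n₁ := m + 1) (n₂ := n₂') (n₃ := n₃') ![A, B, Γ₂, Γ₃] e ∈ Matrix.specialUnitaryGroup (Fin N) ℂ) :
    (0 : suFields N (m + 1) (m + 1) n₂' n₃' × realCoulombSlice (ladderField (n₀ := m + 1) (n₁ := m + 1) (n₂ := n₂') (n₃ := n₃') ![A, B, Γ₂, Γ₃])) ∈
      (sliceChart hAu hBu hω hAB hNm hL).source :=
  HasStrictFDerivAt.mem_toOpenPartialHomeomorph_source _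

/-- ★★ **Small `𝔰𝔲` fluctuations of `L` are small gauge transforms of small Coulomb-slice fluctuations**: `Ψ̂` maps the neighbourhood filter of
`0` ONTO the neighbourhood filter of `0` (`map Ψ̂ (𝓝 0) = 𝓝 0`). [cite: MontvayMunster1994, §3.2.5 p. 122] -/
theorem map_nhds_slicePsiSu_zero (hAu : A ∈ Matrix.unitaryGroup (Fin N) ℂ) (hBu : B ∈ Matrix.unitaryGroup (Fin N) ℂ) (hω : IsPrimitiveRoot ω N)
    (hAB : A * B = ω • (B * A)) (hNm : 2 ≤ N * (m + 1))
    (hL : ∀ e, ladderField (n₀ := m + 1) (n₁ := m + 1) (n₂ := n₂') (n₃ := n₃') ![A, B, Γ₂, Γ₃] e ∈ Matrix.specialUnitaryGroup (Fin N) ℂ) :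
    map (slicePsiSu (ladderField (n₀ := m + 1) (n₁ := m + 1) (n₂ := n₂') (n₃ := n₃') ![A, B, Γ₂, Γ₃])) (𝓝 0) =
      𝓝 (0 : Fin 4 → suFields N (m + 1) (m + 1) n₂' n₃') := by
  haveI : IsUniformAddGroup (suFields N (m + 1) (m + 1) n₂' n₃') := (suFields N (m + 1) (m + 1) n₂' n₃').toAddSubgroup.isUniformAddGroup
  haveI : IsUniformAddGroup (realCoulombSlice (ladderField (n₀ := m + 1) (n₁ := m + 1) (n₂ := n₂') (n₃ := n₃') ![A, B, Γ₂, Γ₃])) :=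
    (realCoulombSlice (ladderField (n₀ := m + 1) (n₁ := m + 1) (n₂ := n₂') (n₃ := n₃') ![A, B, Γ₂, Γ₃])).toAddSubgroup.isUniformAddGroup
  haveI : CompleteSpace (suFields N (m + 1) (m + 1) n₂' n₃') := FiniteDimensional.complete ℝ _
  haveI : CompleteSpace (realCoulombSlice (ladderField (n₀ := m + 1) (n₁ := m + 1) (n₂ := n₂') (n₃ := n₃') ![A, B, Γ₂, Γ₃])) :=
    FiniteDimensional.complete ℝ _
  have h := (hasStrictFDerivAt_slicePsiSu_zero hAu hBu hω hAB hNm hL).map_nhds_eq_of_equiv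
  rwa [slicePsiSu_zero fun e => (Matrix.mem_specialUnitaryGroup_iff.1 (hL e)).1] at h

end Ladder

end Summit.QuantumFields.YangMills.Cruxes.IRcof.TwistedSlab

end
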